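import Summits.QuantumFields.YangMills.Theorems.ColdStartUniversalityLatticeLangevinLiebRobinsonCorrelationFreezing
import Summits.QuantumFields.YangMills.Theorems.ColdStartUniversalityLatticeLangevinCrossCorrelationUniform
import HarnessLib

/-!
# Route `ColdStartUniversality` (fixed-cut-off SZZ dynamics; LIEB–ROBINSON / LOCALITY package, file 16):
# ★★★ EXPONENTIAL CLUSTERING OF THE `SU(2)` WILSON MEASURE ON THE 3-TORUS AT `|β'| < 1/12`, UNIFORMLY IN THE VOLUME —
# Lieb–Robinson light cone + volume-uniform spectral gap

Helper file (seat `ym-line-csu-p1`, g31; `--supports stmt-QuantumFields-24809`).  The static pay-off of the fixed-cut-off dynamics package: the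
finite-volume Wilson measure `μ_(β')` of `SU(2)` lattice Yang–Mills on Bałaban's torus `(ℤ/L)³` has EXPONENTIALLY DECAYING CORRELATIONS at strong
coupling `|β'| < 1/12`, with constants that do not depend on `L` — the finite-volume, volume-uniform counterpart, in the route's own vocabulary, of
Shen–Zhu–Zhu's mass gap (CMP 400 (2023) Cor. 1.6 / Cor. 4.11; the tree's `shen_zhu_zhu_holds` is the infinite-volume DLR statement by the Dobrushin
route).  Mechanism («Lieb–Robinson ⇒ clustering», Hastings–Koma style, for a classical reversible diffusion): interpolate
`Cov_μ(F,G) = [∫FG dμ − ∫F·κ_T G dμ] + [∫F·κ_T G dμ − μF·μG]` along ANY realisation `κ` of the SZZ semigroup; the first bracket is frozen until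
the light cone of `G` reaches the links of `F` (`wilson_integral_mul_transition_sub_le`, file 15: `≤ 8T e^(λT) Σ ℓ^Gℓ^F 108^(−D)`), the second
relaxes at the volume-uniform `L²` rate `ρ = 1 − 12|β'|` (g25/g27); choosing the crossover time `T_R = (R+1) log 108/(λ+ρ)`:
* ★★ `wilson_integral_mul_transition_sub_mean_le` — `|∫ F·κ_t G dμ − μF·μG| ≤ e^(−ρt) √Var F √Var G` (continuous `F, G`);
* ★★★ `wilson_covariance_abs_le` — for `C³` cylinder observables with link-Lipschitz profiles `ℓ^F, ℓ^G` and every `T ≥ 0`: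
  `|Cov_μ(F,G)| ≤ e^(−ρT) √Var F √Var G + 8T e^(λT) Σ_e Σ_e' ℓ^G_e ℓ^F_e' 108^(−D(e',e))`, `λ = (1300+4√2)|β'|`;
* `sqrt_variance_le_of_linkLipschitz` — `√Var F ≤ 2√2 Σ_e ℓ_e`; `doubleSum_profile_le_of_separated`, `exp_mul_crossover_mul_pow_eq` — bookkeeping;
* ★★★ `wilson_covariance_abs_le_of_separated` — profiles supported on link sets at cyclic sup-distance `≥ R+1`:
  `|Cov_μ(F,G)| ≤ (√Var F √Var G + 8 Σℓ^F Σℓ^G · T_R) · e^(−ρ T_R)`, i.e. decay `108^(−ρ(R+1)/(λ+ρ))` — correlation length `≤ (λ+ρ)/(ρ log 108)`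
  lattice spacings for EVERY `L`; ★★★ `wilson_covariance_abs_le_of_separated'` — the profile-only form `8 Σℓ^F Σℓ^G (1 + T_R) e^(−ρT_R)`.
THEOREMS ONLY, no definition, no sorry; [folklore] / [cite: ShenZhuZhu2022, §4.3 Cor. 4.11] / [cite: RobertsRosenthal1997, Theorem 2.1].  HONEST FRAMING:
fixed cut-off and FIXED strong-coupling window `|β'| < 1/12`; the route's scaling `β'_K = (γε_K)⁻¹/2 → ∞` leaves the window, so this says nothing
`K`-uniform and nothing about the continuum limit; `UniformColdStartMixing` (24809) is NOT restated; no crux, rung or summit statement is proved; the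
Yang–Mills mass gap (a WEAK-coupling / continuum statement) is NOT proved.
-/

set_option autoImplicit false

noncomputable section

namespace Summit.QuantumFields.YangMills.Theorems.ColdStartUniversality.LiebRobinson

open MeasureTheory ProbabilityTheory Matrix Complex Finset Filter Set Metric intervalIntegral
open scoped ComplexConjugate BigOperators Matrix NNReal ENNReal Topology
open Literature.Probability.Process Literature.MathematicalPhysics.QuantumFieldTheory
open Literature.MathematicalPhysics.QuantumFieldTheory.Balaban1983to89
open Literature.MathematicalPhysics.QuantumLattice (fundamentalRep fundamentalLatticeRep continuous_fundamentalRep fundamentalRep_apply)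

variable {L : ℕ} [NeZero L]

/-! ## §1. The spectral-gap half: after the light cone the time-correlation has relaxed (`|β'| < 1/12`) -/

/-- ★★ **Relaxation of equilibrium time-correlations at the volume-uniform rate** (`|β'| < 1/12`): for continuous `F, G`, every realising
kernel family, every torus size `L` and every lattice time `t`,
`|∫ F·(κ_t G) dμ_(β') − (∫F dμ_(β'))(∫G dμ_(β'))| ≤ e^(−(1−12|β'|)t)·√Var_μ(F)·√Var_μ(G)` — g27's `wilson_crossCorrelation_le_uniform` for the
centred observables (invariance of `μ_(β')` removes the means). [cite: RobertsRosenthal1997, Theorem 2.1] -/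
theorem wilson_integral_mul_transition_sub_mean_le (L : ℕ) [NeZero L] (β' : ℝ) (hβ : |β'| < 1 / 12)
    (κ : ℝ≥0 → Kernel (GaugeConfig 3 L (Matrix.specialUnitaryGroup (Fin 2) ℂ))
      (GaugeConfig 3 L (Matrix.specialUnitaryGroup (Fin 2) ℂ))) [∀ t, IsMarkovKernel (κ t)]
    (hreal : ∀ (t : ℝ≥0) (x : GaugeConfig 3 L (Matrix.specialUnitaryGroup (Fin 2) ℂ))
        (Ω : Type) [MeasurableSpace Ω] (P : Measure Ω) [IsProbabilityMeasure P]
        (W : ℝ≥0 → Ω → (Edge 3 L × NoiseIdx 2 → ℝ)) (hW : IsFlatBrownian W P)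
        (U : ℝ≥0 → Ω → GaugeConfig 3 L (Matrix.specialUnitaryGroup (Fin 2) ℂ)),
        (∀ ω, U 0 ω = x) →
        (latticeLangevinDynamics (fundamentalLatticeRep 2) β').IsSolution (fundamentalRep (Fin 2))
          hW.natFiltration P W U →
        κ t x = P.map (U t))
    {F G : GaugeConfig 3 L (Matrix.specialUnitaryGroup (Fin 2) ℂ) → ℝ} (hF : Continuous F) (hG : Continuous G) (t : ℝ≥0) :
    |(∫ x, F x * (∫ y, G y ∂(κ t x)) ∂(wilsonMeasure (d := 3) (L := L) (fundamentalRep (Fin 2)) β')) -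
        (∫ x, F x ∂(wilsonMeasure (d := 3) (L := L) (fundamentalRep (Fin 2)) β')) * (∫ x, G x ∂(wilsonMeasure (d := 3) (L := L) (fundamentalRep (Fin 2)) β'))| ≤
      Real.exp (-((1 - 12 * |β'|) * (t : ℝ))) *
        Real.sqrt (∫ x, (F x - ∫ z, F z ∂(wilsonMeasure (d := 3) (L := L) (fundamentalRep (Fin 2)) β')) ^ 2 ∂(wilsonMeasure (d := 3) (L := L) (fundamentalRep (Fin 2)) β')) *
        Real.sqrt (∫ x, (G x - ∫ z, G z ∂(wilsonMeasure (d := 3) (L := L) (fundamentalRep (Fin 2)) β')) ^ 2 ∂(wilsonMeasure (d := 3) (L := L) (fundamentalRep (Fin 2)) β')) := by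
  classical
  haveI := secondCountableTopology_su2
  haveI := borelSpace_config L
  set μ : Measure (GaugeConfig 3 L (Matrix.specialUnitaryGroup (Fin 2) ℂ)) := (wilsonMeasure (d := 3) (L := L) (fundamentalRep (Fin 2)) β') with hμ
  haveI : IsProbabilityMeasure μ :=
    isProbabilityMeasure_wilsonMeasure (d := 3) (L := L) (fundamentalRep (Fin 2)) (continuous_fundamentalRep (Fin 2)) β'
  set mF : ℝ := ∫ x, F x ∂μ with hmF
  set mG : ℝ := ∫ x, G x ∂μ with hmG
  have hFc' : Continuous fun x => F x - mF := hF.sub continuous_const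
  have hGc' : Continuous fun x => G x - mG := hG.sub continuous_const
  have hcent : ∫ x, (G x - mG) ∂μ = 0 := by
    rw [integral_sub (integrable_of_continuous_of_compactSpace hG μ) (integrable_const _), MeasureTheory.integral_const, smul_eq_mul,
      probReal_univ, one_mul, hmG, sub_self]
  have h := wilson_crossCorrelation_le_uniform L β' hβ κ hreal (fun x => G x - mG) (fun x => F x - mF) hGc' hFc' hcent t
  -- the kernels act trivially on constants
  obtain ⟨MG, -, hMG⟩ := exists_abs_le_of_continuous hG
  have hPG : ∀ x, ∫ y, (G y - mG) ∂(κ t x) = (∫ y, G y ∂(κ t x)) - mG := by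
    intro x
    haveI : IsProbabilityMeasure (κ t x) := inferInstance
    have hi : Integrable G (κ t x) := Integrable.of_bound hG.measurable.aestronglyMeasurable MG
      (ae_of_all _ fun y => by rw [Real.norm_eq_abs]; exact hMG y)
    rw [integral_sub hi (integrable_const _), MeasureTheory.integral_const, smul_eq_mul, probReal_univ, one_mul]
  have hκG : Continuous fun x => ∫ y, G y ∂(κ t x) := continuous_integral_transitionKernel L β' κ hreal t hG
  have hinv : ∫ x, (∫ y, G y ∂(κ t x)) ∂μ = mG :=
    integral_transitionKernel_integral_eq_wilson (L := L) β' κ hreal t hG.measurable ⟨MG, hMG⟩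
  have hid : ∫ x, (F x - mF) * (∫ y, (G y - mG) ∂(κ t x)) ∂μ = (∫ x, F x * (∫ y, G y ∂(κ t x)) ∂μ) - mF * mG := by
    have e1 : ∀ x, (F x - mF) * (∫ y, (G y - mG) ∂(κ t x)) =
        F x * (∫ y, G y ∂(κ t x)) - mF * (∫ y, G y ∂(κ t x)) - mG * F x + mF * mG := by
      intro x; rw [hPG x]; ring
    simp_rw [e1]
    have i1 : Integrable (fun x => F x * (∫ y, G y ∂(κ t x))) μ := integrable_of_continuous_of_compactSpace (hF.mul hκG) μ
    have i2 : Integrable (fun x => mF * (∫ y, G y ∂(κ t x))) μ := integrable_of_continuous_of_compactSpace (continuous_const.mul hκG) μ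
    have i3 : Integrable (fun x => mG * F x) μ := integrable_of_continuous_of_compactSpace (continuous_const.mul hF) μ
    have i12 : Integrable (fun x => F x * (∫ y, G y ∂(κ t x)) - mF * (∫ y, G y ∂(κ t x))) μ := i1.sub i2
    have i123 : Integrable (fun x => F x * (∫ y, G y ∂(κ t x)) - mF * (∫ y, G y ∂(κ t x)) - mG * F x) μ := i12.sub i3
    rw [integral_add i123 (integrable_const _), integral_sub i12 i3, integral_sub i1 i2,
      MeasureTheory.integral_const_mul, MeasureTheory.integral_const_mul, hinv, ← hmF, MeasureTheory.integral_const, smul_eq_mul,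
      probReal_univ, one_mul]
    ring
  rw [hid] at h
  have eF : ∫ x, (F x - mF) * (F x - mF) ∂μ = ∫ x, (F x - mF) ^ 2 ∂μ := integral_congr_ae (Eventually.of_forall fun x => by ring)
  have eG : ∫ x, (G x - mG) * (G x - mG) ∂μ = ∫ x, (G x - mG) ^ 2 ∂μ := integral_congr_ae (Eventually.of_forall fun x => by ring)
  rw [eF, eG] at h
  have hexp : Real.exp (-(1 - 12 * |β'|) * (t : ℝ)) = Real.exp (-((1 - 12 * |β'|) * (t : ℝ))) := by ring_nf
  rw [hexp] at h
  calc _ ≤ Real.exp (-((1 - 12 * |β'|) * (t : ℝ))) * Real.sqrt (∫ x, (G x - mG) ^ 2 ∂μ) * Real.sqrt (∫ x, (F x - mF) ^ 2 ∂μ) := h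
    _ = _ := by ring


/-! ## §2. Light cone + gap: the covariance bound for every interpolation time `T` -/

/-- ★★★ **Light cone + gap bound on equilibrium covariances** (`|β'| < 1/12`, every torus size `L`).  For `C³` functions `f, g` of the real
link coordinates whose pull-backs `F = f∘coords`, `G = g∘coords` have link-Lipschitz profiles `ℓ^F, ℓ^G ≥ 0`, and every `T ≥ 0`:
`|Cov_(μ_β')(F, G)| ≤ e^(−ρT)·√Var(F)·√Var(G) + 8·T·e^(λT)·Σ_e Σ_e' ℓ^G_e ℓ^F_e' 108^(−D(e',e))`, `ρ = 1 − 12|β'|`, `λ = (1300+4√2)|β'|`: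
interpolate `Cov(F,G) = [∫FG − ∫F·κ_T G] + [∫F·κ_T G − μF·μG]`, the first bracket frozen by the light cone (`wilson_integral_mul_transition_sub_le`,
after replacing `g` by a compactly supported `C³` function equal to it on the range of `coords`), the second relaxed by the volume-uniform
spectral gap (`wilson_integral_mul_transition_sub_mean_le`).  No dynamics in the statement: the SZZ semigroup is only the interpolating device.
[folklore; cite: ShenZhuZhu2022, §4.3 Cor. 4.11 (shape)] -/
theorem wilson_covariance_abs_le (L : ℕ) [NeZero L] (β' : ℝ) (hβ : |β'| < 1 / 12)
    {f : (Edge 3 L × Fin 2 × Fin 2 × Bool → ℝ) → ℝ} (hf : ContDiff ℝ 3 f) {ℓF : Edge 3 L → ℝ} (hℓF : ∀ e, 0 ≤ ℓF e)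
    {g : (Edge 3 L × Fin 2 × Fin 2 × Bool → ℝ) → ℝ} (hg : ContDiff ℝ 3 g) {ℓG : Edge 3 L → ℝ} (hℓG : ∀ e, 0 ≤ ℓG e)
    {T : ℝ} (hT : 0 ≤ T) :
    let coords : GaugeConfig 3 L (Matrix.specialUnitaryGroup (Fin 2) ℂ) → (Edge 3 L × Fin 2 × Fin 2 × Bool → ℝ) :=
      fun V q => (fun z : ℂ => if q.2.2.2 then z.im else z.re)
        ((fundamentalRep (Fin 2) (V q.1) : Matrix (Fin 2) (Fin 2) ℂ) q.2.1 q.2.2.1)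
    (∀ (e : Edge 3 L) (y y' : (GaugeConfig 3 L (Matrix.specialUnitaryGroup (Fin 2) ℂ))), (∀ f', f' ≠ e → y f' = y' f') →
      |f (coords y) - f (coords y')| ≤ ℓF e * frobNorm ((y e : Matrix (Fin 2) (Fin 2) ℂ) - (y' e : Matrix (Fin 2) (Fin 2) ℂ))) →
    (∀ (e : Edge 3 L) (y y' : (GaugeConfig 3 L (Matrix.specialUnitaryGroup (Fin 2) ℂ))), (∀ f', f' ≠ e → y f' = y' f') →
      |g (coords y) - g (coords y')| ≤ ℓG e * frobNorm ((y e : Matrix (Fin 2) (Fin 2) ℂ) - (y' e : Matrix (Fin 2) (Fin 2) ℂ))) →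
    |(∫ x, f (coords x) * g (coords x) ∂(wilsonMeasure (d := 3) (L := L) (fundamentalRep (Fin 2)) β')) - (∫ x, f (coords x) ∂(wilsonMeasure (d := 3) (L := L) (fundamentalRep (Fin 2)) β')) * (∫ x, g (coords x) ∂(wilsonMeasure (d := 3) (L := L) (fundamentalRep (Fin 2)) β'))| ≤
      Real.exp (-((1 - 12 * |β'|) * T)) * Real.sqrt (∫ x, (f (coords x) - ∫ z, f (coords z) ∂(wilsonMeasure (d := 3) (L := L) (fundamentalRep (Fin 2)) β')) ^ 2 ∂(wilsonMeasure (d := 3) (L := L) (fundamentalRep (Fin 2)) β')) * Real.sqrt (∫ x, (g (coords x) - ∫ z, g (coords z) ∂(wilsonMeasure (d := 3) (L := L) (fundamentalRep (Fin 2)) β')) ^ 2 ∂(wilsonMeasure (d := 3) (L := L) (fundamentalRep (Fin 2)) β')) +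
        8 * T * Real.exp ((1300 + 4 * Real.sqrt 2) * |β'| * T) * ∑ e : Edge 3 L, ∑ e' : Edge 3 L, ℓG e * ℓF e' * ((108 : ℝ)⁻¹) ^ (Finset.univ.sup fun i : Fin 3 => ((e'.1 i - e.1 i).valMinAbs).natAbs) := by
  intro coords hLf hLg
  classical
  haveI := secondCountableTopology_su2
  haveI := borelSpace_config L
  set μ : Measure (GaugeConfig 3 L (Matrix.specialUnitaryGroup (Fin 2) ℂ)) := (wilsonMeasure (d := 3) (L := L) (fundamentalRep (Fin 2)) β') with hμ
  haveI : IsProbabilityMeasure μ :=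
    isProbabilityMeasure_wilsonMeasure (d := 3) (L := L) (fundamentalRep (Fin 2)) (continuous_fundamentalRep (Fin 2)) β'
  obtain ⟨κ, hκ, -, hreal⟩ := exists_transitionKernel L β'
  haveI := hκ
  have hco : Continuous coords := continuous_coords (L := L)
  have hFc : Continuous fun V => f (coords V) := hf.continuous.comp hco
  -- a compactly supported `C³` function equal to `g` on the range of `coords`
  obtain ⟨g', hg', hg'c, hg'eq⟩ := exists_compactSupport_eqOn_unitBall (L := L) hg
  have hgg : ∀ V : (GaugeConfig 3 L (Matrix.specialUnitaryGroup (Fin 2) ℂ)), g' (coords V) = g (coords V) :=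
    fun V => hg'eq _ (norm_flatCoords_le_one (L := L) V)
  have hG'c : Continuous fun V => g' (coords V) := hg'.continuous.comp hco
  have hLg' : (∀ (e : Edge 3 L) (y y' : (GaugeConfig 3 L (Matrix.specialUnitaryGroup (Fin 2) ℂ))), (∀ f', f' ≠ e → y f' = y' f') →
      |g' (coords y) - g' (coords y')| ≤ ℓG e * frobNorm ((y e : Matrix (Fin 2) (Fin 2) ℂ) - (y' e : Matrix (Fin 2) (Fin 2) ℂ))) := by
    intro e y y' h; rw [hgg, hgg]; exact hLg e y y' h
  have h1 : |(∫ x, f (coords x) * (∫ y, g' (coords y) ∂(κ T.toNNReal x)) ∂μ) - ∫ x, f (coords x) * g' (coords x) ∂μ| ≤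
      8 * T * Real.exp ((1300 + 4 * Real.sqrt 2) * |β'| * T) * ∑ e : Edge 3 L, ∑ e' : Edge 3 L, ℓG e * ℓF e' * ((108 : ℝ)⁻¹) ^ (Finset.univ.sup fun i : Fin 3 => ((e'.1 i - e.1 i).valMinAbs).natAbs) :=
    wilson_integral_mul_transition_sub_le L β' κ hreal hf hℓF hg' hg'c hℓG hT hLf hLg'
  have h2 : |(∫ x, f (coords x) * (∫ y, g' (coords y) ∂(κ T.toNNReal x)) ∂μ) - (∫ x, f (coords x) ∂μ) * (∫ x, g' (coords x) ∂μ)| ≤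
      Real.exp (-((1 - 12 * |β'|) * ((T.toNNReal : ℝ≥0) : ℝ))) * Real.sqrt (∫ x, (f (coords x) - ∫ z, f (coords z) ∂μ) ^ 2 ∂μ) *
        Real.sqrt (∫ x, (g' (coords x) - ∫ z, g' (coords z) ∂μ) ^ 2 ∂μ) :=
    wilson_integral_mul_transition_sub_mean_le L β' hβ κ hreal hFc hG'c T.toNNReal
  have hTc : ((T.toNNReal : ℝ≥0) : ℝ) = T := Real.coe_toNNReal _ hT
  rw [hTc] at h2
  simp only [← hgg]
  calc |(∫ x, f (coords x) * g' (coords x) ∂μ) - (∫ x, f (coords x) ∂μ) * (∫ x, g' (coords x) ∂μ)|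
      = |-((∫ x, f (coords x) * (∫ y, g' (coords y) ∂(κ T.toNNReal x)) ∂μ) - ∫ x, f (coords x) * g' (coords x) ∂μ) +
          ((∫ x, f (coords x) * (∫ y, g' (coords y) ∂(κ T.toNNReal x)) ∂μ) - (∫ x, f (coords x) ∂μ) * (∫ x, g' (coords x) ∂μ))| := by
        congr 1; ring
    _ ≤ |-((∫ x, f (coords x) * (∫ y, g' (coords y) ∂(κ T.toNNReal x)) ∂μ) - ∫ x, f (coords x) * g' (coords x) ∂μ)| +
          |(∫ x, f (coords x) * (∫ y, g' (coords y) ∂(κ T.toNNReal x)) ∂μ) - (∫ x, f (coords x) ∂μ) * (∫ x, g' (coords x) ∂μ)| :=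
        abs_add_le _ _
    _ ≤ 8 * T * Real.exp ((1300 + 4 * Real.sqrt 2) * |β'| * T) * (∑ e : Edge 3 L, ∑ e' : Edge 3 L, ℓG e * ℓF e' * ((108 : ℝ)⁻¹) ^ (Finset.univ.sup fun i : Fin 3 => ((e'.1 i - e.1 i).valMinAbs).natAbs)) +
          Real.exp (-((1 - 12 * |β'|) * T)) * Real.sqrt (∫ x, (f (coords x) - ∫ z, f (coords z) ∂μ) ^ 2 ∂μ) *
            Real.sqrt (∫ x, (g' (coords x) - ∫ z, g' (coords z) ∂μ) ^ 2 ∂μ) := by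
        rw [abs_neg]; exact add_le_add h1 h2
    _ = _ := by rw [add_comm]


/-! ## §3. EXPONENTIAL CLUSTERING, uniformly in the volume -/

/-- **Oscillation bound on the variance from a link-Lipschitz profile** (every coupling): if a continuous `F` is `ℓ_e`-Lipschitz in each link
(Frobenius distance, other links frozen) then `√Var_(μ_β')(F) ≤ 2√2·Σ_e ℓ_e` (telescoping over links, `‖U − V‖_F ≤ 2√2` on `SU(2)`). [folklore] -/
theorem sqrt_variance_le_of_linkLipschitz (L : ℕ) [NeZero L] (β' : ℝ)
    {F : GaugeConfig 3 L (Matrix.specialUnitaryGroup (Fin 2) ℂ) → ℝ} (hF : Continuous F) {ℓ : Edge 3 L → ℝ} (hℓ : ∀ e, 0 ≤ ℓ e)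
    (hLip : ∀ (e : Edge 3 L) (y y' : (GaugeConfig 3 L (Matrix.specialUnitaryGroup (Fin 2) ℂ))), (∀ f', f' ≠ e → y f' = y' f') →
      |F y - F y'| ≤ ℓ e * frobNorm ((y e : Matrix (Fin 2) (Fin 2) ℂ) - (y' e : Matrix (Fin 2) (Fin 2) ℂ))) :
    Real.sqrt (∫ x, (F x - ∫ z, F z ∂(wilsonMeasure (d := 3) (L := L) (fundamentalRep (Fin 2)) β')) ^ 2 ∂(wilsonMeasure (d := 3) (L := L) (fundamentalRep (Fin 2)) β')) ≤ 2 * Real.sqrt 2 * ∑ e : Edge 3 L, ℓ e := by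
  classical
  haveI := secondCountableTopology_su2
  haveI := borelSpace_config L
  set μ : Measure (GaugeConfig 3 L (Matrix.specialUnitaryGroup (Fin 2) ℂ)) := (wilsonMeasure (d := 3) (L := L) (fundamentalRep (Fin 2)) β') with hμ
  haveI : IsProbabilityMeasure μ :=
    isProbabilityMeasure_wilsonMeasure (d := 3) (L := L) (fundamentalRep (Fin 2)) (continuous_fundamentalRep (Fin 2)) β'
  set C : ℝ := 2 * Real.sqrt 2 * ∑ e : Edge 3 L, ℓ e with hC
  have hC0 : 0 ≤ C := by rw [hC]; exact mul_nonneg (by positivity) (Finset.sum_nonneg fun e _ => hℓ e)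
  have hosc : ∀ y y' : (GaugeConfig 3 L (Matrix.specialUnitaryGroup (Fin 2) ℂ)), |F y - F y'| ≤ C := by
    intro y y'
    refine (abs_sub_le_sum_linkLipschitz ℓ hLip y y').trans ?_
    rw [hC, Finset.mul_sum]
    refine Finset.sum_le_sum fun e _ => ?_
    have h2 := frobNorm_sub_le_of_mem_unitaryGroup (Matrix.specialUnitaryGroup_le_unitaryGroup (y e).2)
      (Matrix.specialUnitaryGroup_le_unitaryGroup (y' e).2)
    rw [Fintype.card_fin] at h2
    have hd : frobNorm ((y e : Matrix (Fin 2) (Fin 2) ℂ) - (y' e : Matrix (Fin 2) (Fin 2) ℂ)) ≤ 2 * Real.sqrt 2 := by exact_mod_cast h2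
    calc ℓ e * frobNorm ((y e : Matrix (Fin 2) (Fin 2) ℂ) - (y' e : Matrix (Fin 2) (Fin 2) ℂ)) ≤ ℓ e * (2 * Real.sqrt 2) :=
        mul_le_mul_of_nonneg_left hd (hℓ e)
      _ = 2 * Real.sqrt 2 * ℓ e := by ring
  have hFi : Integrable F μ := integrable_of_continuous_of_compactSpace hF μ
  have hdev : ∀ y, |F y - ∫ z, F z ∂μ| ≤ C := by
    intro y
    have e1 : F y - ∫ z, F z ∂μ = ∫ z, (F y - F z) ∂μ := by
      rw [integral_sub (integrable_const _) hFi, MeasureTheory.integral_const, smul_eq_mul, probReal_univ, one_mul]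
    rw [e1]
    calc |∫ z, (F y - F z) ∂μ| ≤ ∫ z, |F y - F z| ∂μ := MeasureTheory.abs_integral_le_integral_abs
      _ ≤ ∫ _z, C ∂μ := integral_mono_of_nonneg (Eventually.of_forall fun z => abs_nonneg _) (integrable_const C)
          (Eventually.of_forall fun z => hosc y z)
      _ = C := by rw [MeasureTheory.integral_const, smul_eq_mul, probReal_univ, one_mul]
  have hsq : ∫ x, (F x - ∫ z, F z ∂μ) ^ 2 ∂μ ≤ C ^ 2 := by
    calc ∫ x, (F x - ∫ z, F z ∂μ) ^ 2 ∂μ ≤ ∫ _x, C ^ 2 ∂μ :=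
          integral_mono_of_nonneg (Eventually.of_forall fun x => sq_nonneg _) (integrable_const _)
            (Eventually.of_forall fun x => by
              have h := hdev x
              have h' := abs_le.1 h
              nlinarith [h'.1, h'.2, hC0])
      _ = C ^ 2 := by rw [MeasureTheory.integral_const, smul_eq_mul, probReal_univ, one_mul]
  calc Real.sqrt (∫ x, (F x - ∫ z, F z ∂μ) ^ 2 ∂μ) ≤ Real.sqrt (C ^ 2) := Real.sqrt_le_sqrt hsq
    _ = C := Real.sqrt_sq hC0

/-- **Separated profiles.**  If `ℓ^F` vanishes off `Λ_F`, `ℓ^G` off `Λ_G`, both are nonnegative, and every base site of `Λ_F` is at cyclic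
sup-distance `≥ R+1` from every base site of `Λ_G`, then `Σ_e Σ_e' ℓ^G_e ℓ^F_e' 108^(−D(e',e)) ≤ 108^(−(R+1))·(Σℓ^F)(Σℓ^G)`. [folklore] -/
theorem doubleSum_profile_le_of_separated {ℓF ℓG : Edge 3 L → ℝ} (hℓF : ∀ e, 0 ≤ ℓF e) (hℓG : ∀ e, 0 ≤ ℓG e)
    (Λf Λg : Finset (Edge 3 L)) (hΛf : ∀ e, e ∉ Λf → ℓF e = 0) (hΛg : ∀ e, e ∉ Λg → ℓG e = 0) (R : ℕ)
    (hsep : ∀ e' ∈ Λf, ∀ e ∈ Λg, R + 1 ≤ (Finset.univ.sup fun i : Fin 3 => ((e'.1 i - e.1 i).valMinAbs).natAbs)) :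
    ∑ e : Edge 3 L, ∑ e' : Edge 3 L, ℓG e * ℓF e' * ((108 : ℝ)⁻¹) ^ (Finset.univ.sup fun i : Fin 3 => ((e'.1 i - e.1 i).valMinAbs).natAbs) ≤ ((108 : ℝ)⁻¹) ^ (R + 1) * ((∑ e : Edge 3 L, ℓF e) * ∑ e : Edge 3 L, ℓG e) := by
  classical
  have hterm : ∀ e e' : Edge 3 L, ℓG e * ℓF e' * ((108 : ℝ)⁻¹) ^ (Finset.univ.sup fun i : Fin 3 => ((e'.1 i - e.1 i).valMinAbs).natAbs) ≤ ℓG e * ℓF e' * ((108 : ℝ)⁻¹) ^ (R + 1) := by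
    intro e e'
    by_cases he : e ∈ Λg
    · by_cases he' : e' ∈ Λf
      · exact mul_le_mul_of_nonneg_left (pow_le_pow_of_le_one (by norm_num) (by norm_num) (hsep e' he' e he))
          (mul_nonneg (hℓG e) (hℓF e'))
      · rw [hΛf e' he', mul_zero, zero_mul, zero_mul]
    · rw [hΛg e he, zero_mul, zero_mul, zero_mul]
  calc ∑ e : Edge 3 L, ∑ e' : Edge 3 L, ℓG e * ℓF e' * ((108 : ℝ)⁻¹) ^ (Finset.univ.sup fun i : Fin 3 => ((e'.1 i - e.1 i).valMinAbs).natAbs) ≤ ∑ e : Edge 3 L, ∑ e' : Edge 3 L, ℓG e * ℓF e' * ((108 : ℝ)⁻¹) ^ (R + 1) :=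
      Finset.sum_le_sum fun e _ => Finset.sum_le_sum fun e' _ => hterm e e'
    _ = ((108 : ℝ)⁻¹) ^ (R + 1) * ((∑ e : Edge 3 L, ℓF e) * ∑ e : Edge 3 L, ℓG e) := by
      have hin : ∀ e : Edge 3 L, ∑ e' : Edge 3 L, ℓG e * ℓF e' * ((108 : ℝ)⁻¹) ^ (R + 1) =
          ℓG e * ((∑ e' : Edge 3 L, ℓF e') * ((108 : ℝ)⁻¹) ^ (R + 1)) := fun e => by
        rw [Finset.sum_mul, Finset.mul_sum]
        exact Finset.sum_congr rfl fun e' _ => by ring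
      rw [Finset.sum_congr rfl fun e _ => hin e, ← Finset.sum_mul]
      ring

omit [NeZero L] in
/-- **The crossover time.**  With `T_R = (R+1)·log 108/(λ+ρ)` (`λ = (1300+4√2)|β'|`, `ρ = 1 − 12|β'|`, `λ + ρ > 0`), the light-cone factor and
the relaxation factor coincide: `e^(λ·T_R)·108^(−(R+1)) = e^(−ρ·T_R)`. [folklore] -/
theorem exp_mul_crossover_mul_pow_eq (β' : ℝ) (R : ℕ) (hden : 0 < (1300 + 4 * Real.sqrt 2) * |β'| + (1 - 12 * |β'|)) :
    Real.exp ((1300 + 4 * Real.sqrt 2) * |β'| * (((R : ℝ) + 1) * Real.log 108 / ((1300 + 4 * Real.sqrt 2) * |β'| + (1 - 12 * |β'|)))) * ((108 : ℝ)⁻¹) ^ (R + 1) = Real.exp (-((1 - 12 * |β'|) * (((R : ℝ) + 1) * Real.log 108 / ((1300 + 4 * Real.sqrt 2) * |β'| + (1 - 12 * |β'|))))) := by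
  have hpow : ((108 : ℝ)⁻¹) ^ (R + 1) = Real.exp (-(((R : ℝ) + 1) * Real.log 108)) := by
    rw [Real.exp_neg, show ((R : ℝ) + 1) = ((R + 1 : ℕ) : ℝ) by push_cast; ring, Real.exp_nat_mul,
      Real.exp_log (by norm_num : (0 : ℝ) < 108), inv_pow]
  rw [hpow, ← Real.exp_add]
  congr 1
  have hTeq : ((1300 + 4 * Real.sqrt 2) * |β'| + (1 - 12 * |β'|)) * (((R : ℝ) + 1) * Real.log 108 / ((1300 + 4 * Real.sqrt 2) * |β'| + (1 - 12 * |β'|))) = ((R : ℝ) + 1) * Real.log 108 := mul_div_cancel₀ _ hden.ne'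
  linarith

/-- ★★★ **EXPONENTIAL CLUSTERING OF THE `SU(2)` WILSON MEASURE ON THE 3-TORUS AT `|β'| < 1/12`, UNIFORMLY IN THE VOLUME.**  For every torus
size `L`, all `C³` functions `f, g` of the real link coordinates whose pull-backs `F = f∘coords`, `G = g∘coords` have link-Lipschitz profiles
`ℓ^F, ℓ^G ≥ 0` supported in sets of links `Λ_F`, `Λ_G` whose base sites are at cyclic sup-distance `≥ R + 1` from each other:
`|Cov_(μ_β')(F, G)| ≤ (√Var F·√Var G + 8·(Σℓ^F)(Σℓ^G)·T_R)·exp(−ρ·T_R)`,  `T_R = (R+1)·log 108/(λ+ρ)`, `ρ = 1 − 12|β'|`, `λ = (1300+4√2)|β'|`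
— i.e. correlations decay like `108^(−ρ(R+1)/(λ+ρ))`: a correlation length of at most `(λ+ρ)/(ρ·log 108)` lattice spacings, the same for every `L`
(`wilson_covariance_abs_le` at the crossover time `T_R` where the light-cone error `e^(λT)·108^(−(R+1))` meets the relaxation `e^(−ρT)`).
Fixed cut-off, strong-coupling window only; `UniformColdStartMixing` (24809) is NOT restated; the Yang–Mills mass gap is NOT proved.
[folklore; cite: ShenZhuZhu2022, §4.3 Cor. 4.11 / Cor. 1.6 (shape: exponential clustering at strong coupling)] -/
theorem wilson_covariance_abs_le_of_separated (L : ℕ) [NeZero L] (β' : ℝ) (hβ : |β'| < 1 / 12)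
    {f : (Edge 3 L × Fin 2 × Fin 2 × Bool → ℝ) → ℝ} (hf : ContDiff ℝ 3 f) {ℓF : Edge 3 L → ℝ} (hℓF : ∀ e, 0 ≤ ℓF e)
    {g : (Edge 3 L × Fin 2 × Fin 2 × Bool → ℝ) → ℝ} (hg : ContDiff ℝ 3 g) {ℓG : Edge 3 L → ℝ} (hℓG : ∀ e, 0 ≤ ℓG e)
    (Λf Λg : Finset (Edge 3 L)) (hΛf : ∀ e, e ∉ Λf → ℓF e = 0) (hΛg : ∀ e, e ∉ Λg → ℓG e = 0) (R : ℕ)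
    (hsep : ∀ e' ∈ Λf, ∀ e ∈ Λg, R + 1 ≤ (Finset.univ.sup fun i : Fin 3 => ((e'.1 i - e.1 i).valMinAbs).natAbs)) :
    let coords : GaugeConfig 3 L (Matrix.specialUnitaryGroup (Fin 2) ℂ) → (Edge 3 L × Fin 2 × Fin 2 × Bool → ℝ) :=
      fun V q => (fun z : ℂ => if q.2.2.2 then z.im else z.re)
        ((fundamentalRep (Fin 2) (V q.1) : Matrix (Fin 2) (Fin 2) ℂ) q.2.1 q.2.2.1)
    (∀ (e : Edge 3 L) (y y' : (GaugeConfig 3 L (Matrix.specialUnitaryGroup (Fin 2) ℂ))), (∀ f', f' ≠ e → y f' = y' f') →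
      |f (coords y) - f (coords y')| ≤ ℓF e * frobNorm ((y e : Matrix (Fin 2) (Fin 2) ℂ) - (y' e : Matrix (Fin 2) (Fin 2) ℂ))) →
    (∀ (e : Edge 3 L) (y y' : (GaugeConfig 3 L (Matrix.specialUnitaryGroup (Fin 2) ℂ))), (∀ f', f' ≠ e → y f' = y' f') →
      |g (coords y) - g (coords y')| ≤ ℓG e * frobNorm ((y e : Matrix (Fin 2) (Fin 2) ℂ) - (y' e : Matrix (Fin 2) (Fin 2) ℂ))) →
    |(∫ x, f (coords x) * g (coords x) ∂(wilsonMeasure (d := 3) (L := L) (fundamentalRep (Fin 2)) β')) - (∫ x, f (coords x) ∂(wilsonMeasure (d := 3) (L := L) (fundamentalRep (Fin 2)) β')) * (∫ x, g (coords x) ∂(wilsonMeasure (d := 3) (L := L) (fundamentalRep (Fin 2)) β'))| ≤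
      (Real.sqrt (∫ x, (f (coords x) - ∫ z, f (coords z) ∂(wilsonMeasure (d := 3) (L := L) (fundamentalRep (Fin 2)) β')) ^ 2 ∂(wilsonMeasure (d := 3) (L := L) (fundamentalRep (Fin 2)) β')) * Real.sqrt (∫ x, (g (coords x) - ∫ z, g (coords z) ∂(wilsonMeasure (d := 3) (L := L) (fundamentalRep (Fin 2)) β')) ^ 2 ∂(wilsonMeasure (d := 3) (L := L) (fundamentalRep (Fin 2)) β')) + 8 * (∑ e : Edge 3 L, ℓF e) * (∑ e : Edge 3 L, ℓG e) * (((R : ℝ) + 1) * Real.log 108 / ((1300 + 4 * Real.sqrt 2) * |β'| + (1 - 12 * |β'|)))) *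
        Real.exp (-((1 - 12 * |β'|) * (((R : ℝ) + 1) * Real.log 108 / ((1300 + 4 * Real.sqrt 2) * |β'| + (1 - 12 * |β'|))))) := by
  intro coords hLf hLg
  classical
  have hlam0 : 0 ≤ (1300 + 4 * Real.sqrt 2) * |β'| := by positivity
  have hrho : 0 < (1 - 12 * |β'|) := by linarith
  have hden : 0 < (1300 + 4 * Real.sqrt 2) * |β'| + (1 - 12 * |β'|) := by linarith
  have hlog : 0 < Real.log 108 := Real.log_pos (by norm_num)
  set T : ℝ := (((R : ℝ) + 1) * Real.log 108 / ((1300 + 4 * Real.sqrt 2) * |β'| + (1 - 12 * |β'|))) with hTdef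
  have hT : 0 ≤ T := by rw [hTdef]; positivity
  have key : |(∫ x, f (coords x) * g (coords x) ∂(wilsonMeasure (d := 3) (L := L) (fundamentalRep (Fin 2)) β')) - (∫ x, f (coords x) ∂(wilsonMeasure (d := 3) (L := L) (fundamentalRep (Fin 2)) β')) * (∫ x, g (coords x) ∂(wilsonMeasure (d := 3) (L := L) (fundamentalRep (Fin 2)) β'))| ≤ Real.exp (-((1 - 12 * |β'|) * T)) * Real.sqrt (∫ x, (f (coords x) - ∫ z, f (coords z) ∂(wilsonMeasure (d := 3) (L := L) (fundamentalRep (Fin 2)) β')) ^ 2 ∂(wilsonMeasure (d := 3) (L := L) (fundamentalRep (Fin 2)) β')) * Real.sqrt (∫ x, (g (coords x) - ∫ z, g (coords z) ∂(wilsonMeasure (d := 3) (L := L) (fundamentalRep (Fin 2)) β')) ^ 2 ∂(wilsonMeasure (d := 3) (L := L) (fundamentalRep (Fin 2)) β')) + 8 * T * Real.exp ((1300 + 4 * Real.sqrt 2) * |β'| * T) * ∑ e : Edge 3 L, ∑ e' : Edge 3 L, ℓG e * ℓF e' * ((108 : ℝ)⁻¹) ^ (Finset.univ.sup fun i : Fin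 3 => ((e'.1 i - e.1 i).valMinAbs).natAbs) :=
    wilson_covariance_abs_le L β' hβ hf hℓF hg hℓG hT hLf hLg
  have hS := doubleSum_profile_le_of_separated hℓF hℓG Λf Λg hΛf hΛg R hsep
  have hcross : Real.exp ((1300 + 4 * Real.sqrt 2) * |β'| * T) * ((108 : ℝ)⁻¹) ^ (R + 1) = Real.exp (-((1 - 12 * |β'|) * T)) := by
    rw [hTdef]; exact exp_mul_crossover_mul_pow_eq β' R hden
  have hVF : 0 ≤ Real.sqrt (∫ x, (f (coords x) - ∫ z, f (coords z) ∂(wilsonMeasure (d := 3) (L := L) (fundamentalRep (Fin 2)) β')) ^ 2 ∂(wilsonMeasure (d := 3) (L := L) (fundamentalRep (Fin 2)) β')) := Real.sqrt_nonneg _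
  have hVG : 0 ≤ Real.sqrt (∫ x, (g (coords x) - ∫ z, g (coords z) ∂(wilsonMeasure (d := 3) (L := L) (fundamentalRep (Fin 2)) β')) ^ 2 ∂(wilsonMeasure (d := 3) (L := L) (fundamentalRep (Fin 2)) β')) := Real.sqrt_nonneg _
  have hSF : 0 ≤ ∑ e : Edge 3 L, ℓF e := Finset.sum_nonneg fun e _ => hℓF e
  have hSG : 0 ≤ ∑ e : Edge 3 L, ℓG e := Finset.sum_nonneg fun e _ => hℓG e
  have hE0 : 0 ≤ Real.exp ((1300 + 4 * Real.sqrt 2) * |β'| * T) := (Real.exp_pos _).le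
  refine key.trans ?_
  have h2 : 8 * T * Real.exp ((1300 + 4 * Real.sqrt 2) * |β'| * T) * ∑ e : Edge 3 L, ∑ e' : Edge 3 L, ℓG e * ℓF e' * ((108 : ℝ)⁻¹) ^ (Finset.univ.sup fun i : Fin 3 => ((e'.1 i - e.1 i).valMinAbs).natAbs) ≤
      8 * T * ((∑ e : Edge 3 L, ℓF e) * ∑ e : Edge 3 L, ℓG e) * Real.exp (-((1 - 12 * |β'|) * T)) := by
    calc 8 * T * Real.exp ((1300 + 4 * Real.sqrt 2) * |β'| * T) * ∑ e : Edge 3 L, ∑ e' : Edge 3 L, ℓG e * ℓF e' * ((108 : ℝ)⁻¹) ^ (Finset.univ.sup fun i : Fin 3 => ((e'.1 i - e.1 i).valMinAbs).natAbs)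
        ≤ 8 * T * Real.exp ((1300 + 4 * Real.sqrt 2) * |β'| * T) * (((108 : ℝ)⁻¹) ^ (R + 1) * ((∑ e : Edge 3 L, ℓF e) * ∑ e : Edge 3 L, ℓG e)) :=
          mul_le_mul_of_nonneg_left hS (by positivity)
      _ = 8 * T * ((∑ e : Edge 3 L, ℓF e) * ∑ e : Edge 3 L, ℓG e) * (Real.exp ((1300 + 4 * Real.sqrt 2) * |β'| * T) * ((108 : ℝ)⁻¹) ^ (R + 1)) := by ring
      _ = _ := by rw [hcross]
  calc Real.exp (-((1 - 12 * |β'|) * T)) * Real.sqrt (∫ x, (f (coords x) - ∫ z, f (coords z) ∂(wilsonMeasure (d := 3) (L := L) (fundamentalRep (Fin 2)) β')) ^ 2 ∂(wilsonMeasure (d := 3) (L := L) (fundamentalRep (Fin 2)) β')) * Real.sqrt (∫ x, (g (coords x) - ∫ z, g (coords z) ∂(wilsonMeasure (d := 3) (L := L) (fundamentalRep (Fin 2)) β')) ^ 2 ∂(wilsonMeasure (d := 3) (L := L) (fundamentalRep (Fin 2)) β')) + 8 * T * Real.exp ((1300 + 4 * Real.sqrt 2) * |β'| * T) * ∑ e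 : Edge 3 L, ∑ e' : Edge 3 L, ℓG e * ℓF e' * ((108 : ℝ)⁻¹) ^ (Finset.univ.sup fun i : Fin 3 => ((e'.1 i - e.1 i).valMinAbs).natAbs)
      ≤ Real.exp (-((1 - 12 * |β'|) * T)) * Real.sqrt (∫ x, (f (coords x) - ∫ z, f (coords z) ∂(wilsonMeasure (d := 3) (L := L) (fundamentalRep (Fin 2)) β')) ^ 2 ∂(wilsonMeasure (d := 3) (L := L) (fundamentalRep (Fin 2)) β')) * Real.sqrt (∫ x, (g (coords x) - ∫ z, g (coords z) ∂(wilsonMeasure (d := 3) (L := L) (fundamentalRep (Fin 2)) β')) ^ 2 ∂(wilsonMeasure (d := 3) (L := L) (fundamentalRep (Fin 2)) β')) + 8 * T * ((∑ e : Edge 3 L, ℓF e) * ∑ e : Edge 3 L, ℓG e) * Real.exp (-((1 - 12 * |β'|) * T)) :=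
        add_le_add le_rfl h2
    _ = _ := by ring

/-- ★★★ **Exponential clustering — profile-only form.**  Same setting (`|β'| < 1/12`, every `L`, supports `(R+1)`-separated):
`|Cov_(μ_β')(F, G)| ≤ 8·(Σ_e ℓ^F_e)·(Σ_e ℓ^G_e)·(1 + T_R)·exp(−ρ·T_R)`, `T_R = (R+1) log 108/(λ+ρ)` — everything explicit, nothing depends on the
volume (`√Var ≤ 2√2·Σℓ`, `sqrt_variance_le_of_linkLipschitz`).  Fixed cut-off; the Yang–Mills mass gap is NOT proved. [folklore] -/
theorem wilson_covariance_abs_le_of_separated' (L : ℕ) [NeZero L] (β' : ℝ) (hβ : |β'| < 1 / 12)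
    {f : (Edge 3 L × Fin 2 × Fin 2 × Bool → ℝ) → ℝ} (hf : ContDiff ℝ 3 f) {ℓF : Edge 3 L → ℝ} (hℓF : ∀ e, 0 ≤ ℓF e)
    {g : (Edge 3 L × Fin 2 × Fin 2 × Bool → ℝ) → ℝ} (hg : ContDiff ℝ 3 g) {ℓG : Edge 3 L → ℝ} (hℓG : ∀ e, 0 ≤ ℓG e)
    (Λf Λg : Finset (Edge 3 L)) (hΛf : ∀ e, e ∉ Λf → ℓF e = 0) (hΛg : ∀ e, e ∉ Λg → ℓG e = 0) (R : ℕ)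
    (hsep : ∀ e' ∈ Λf, ∀ e ∈ Λg, R + 1 ≤ (Finset.univ.sup fun i : Fin 3 => ((e'.1 i - e.1 i).valMinAbs).natAbs)) :
    let coords : GaugeConfig 3 L (Matrix.specialUnitaryGroup (Fin 2) ℂ) → (Edge 3 L × Fin 2 × Fin 2 × Bool → ℝ) :=
      fun V q => (fun z : ℂ => if q.2.2.2 then z.im else z.re)
        ((fundamentalRep (Fin 2) (V q.1) : Matrix (Fin 2) (Fin 2) ℂ) q.2.1 q.2.2.1)
    (∀ (e : Edge 3 L) (y y' : (GaugeConfig 3 L (Matrix.specialUnitaryGroup (Fin 2) ℂ))), (∀ f', f' ≠ e → y f' = y' f') →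
      |f (coords y) - f (coords y')| ≤ ℓF e * frobNorm ((y e : Matrix (Fin 2) (Fin 2) ℂ) - (y' e : Matrix (Fin 2) (Fin 2) ℂ))) →
    (∀ (e : Edge 3 L) (y y' : (GaugeConfig 3 L (Matrix.specialUnitaryGroup (Fin 2) ℂ))), (∀ f', f' ≠ e → y f' = y' f') →
      |g (coords y) - g (coords y')| ≤ ℓG e * frobNorm ((y e : Matrix (Fin 2) (Fin 2) ℂ) - (y' e : Matrix (Fin 2) (Fin 2) ℂ))) →
    |(∫ x, f (coords x) * g (coords x) ∂(wilsonMeasure (d := 3) (L := L) (fundamentalRep (Fin 2)) β')) - (∫ x, f (coords x) ∂(wilsonMeasure (d := 3) (L := L) (fundamentalRep (Fin 2)) β')) * (∫ x, g (coords x) ∂(wilsonMeasure (d := 3) (L := L) (fundamentalRep (Fin 2)) β'))| ≤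
      8 * (∑ e : Edge 3 L, ℓF e) * (∑ e : Edge 3 L, ℓG e) * (1 + (((R : ℝ) + 1) * Real.log 108 / ((1300 + 4 * Real.sqrt 2) * |β'| + (1 - 12 * |β'|)))) * Real.exp (-((1 - 12 * |β'|) * (((R : ℝ) + 1) * Real.log 108 / ((1300 + 4 * Real.sqrt 2) * |β'| + (1 - 12 * |β'|))))) := by
  intro coords hLf hLg
  have key := wilson_covariance_abs_le_of_separated L β' hβ hf hℓF hg hℓG Λf Λg hΛf hΛg R hsep hLf hLg
  refine key.trans ?_
  have hco : Continuous coords := continuous_coords (L := L)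
  have hVF := sqrt_variance_le_of_linkLipschitz L β' (hf.continuous.comp hco) hℓF hLf
  have hVG := sqrt_variance_le_of_linkLipschitz L β' (hg.continuous.comp hco) hℓG hLg
  have hlam0 : 0 ≤ (1300 + 4 * Real.sqrt 2) * |β'| := by positivity
  have hrho : 0 < (1 - 12 * |β'|) := by linarith
  have hden : 0 < (1300 + 4 * Real.sqrt 2) * |β'| + (1 - 12 * |β'|) := by linarith
  have hlog : 0 < Real.log 108 := Real.log_pos (by norm_num)
  have hT : 0 ≤ (((R : ℝ) + 1) * Real.log 108 / ((1300 + 4 * Real.sqrt 2) * |β'| + (1 - 12 * |β'|))) := by positivity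
  have hSF : 0 ≤ ∑ e : Edge 3 L, ℓF e := Finset.sum_nonneg fun e _ => hℓF e
  have hSG : 0 ≤ ∑ e : Edge 3 L, ℓG e := Finset.sum_nonneg fun e _ => hℓG e
  have hprod : Real.sqrt (∫ x, (f (coords x) - ∫ z, f (coords z) ∂(wilsonMeasure (d := 3) (L := L) (fundamentalRep (Fin 2)) β')) ^ 2 ∂(wilsonMeasure (d := 3) (L := L) (fundamentalRep (Fin 2)) β')) * Real.sqrt (∫ x, (g (coords x) - ∫ z, g (coords z) ∂(wilsonMeasure (d := 3) (L := L) (fundamentalRep (Fin 2)) β')) ^ 2 ∂(wilsonMeasure (d := 3) (L := L) (fundamentalRep (Fin 2)) β')) ≤ 8 * (∑ e : Edge 3 L, ℓF e) * (∑ e : Edge 3 L, ℓG e) := by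
    have hs : Real.sqrt 2 * Real.sqrt 2 = 2 := Real.mul_self_sqrt (by norm_num)
    calc Real.sqrt (∫ x, (f (coords x) - ∫ z, f (coords z) ∂(wilsonMeasure (d := 3) (L := L) (fundamentalRep (Fin 2)) β')) ^ 2 ∂(wilsonMeasure (d := 3) (L := L) (fundamentalRep (Fin 2)) β')) * Real.sqrt (∫ x, (g (coords x) - ∫ z, g (coords z) ∂(wilsonMeasure (d := 3) (L := L) (fundamentalRep (Fin 2)) β')) ^ 2 ∂(wilsonMeasure (d := 3) (L := L) (fundamentalRep (Fin 2)) β')) ≤ (2 * Real.sqrt 2 * ∑ e : Edge 3 L, ℓF e) * (2 * Real.sqrt 2 * ∑ e : Edge 3 L, ℓG e) :=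
        mul_le_mul hVF hVG (Real.sqrt_nonneg _) (by positivity)
      _ = 4 * (Real.sqrt 2 * Real.sqrt 2) * (∑ e : Edge 3 L, ℓF e) * (∑ e : Edge 3 L, ℓG e) := by ring
      _ = 8 * (∑ e : Edge 3 L, ℓF e) * (∑ e : Edge 3 L, ℓG e) := by rw [hs]; ring
  have hE : 0 ≤ Real.exp (-((1 - 12 * |β'|) * (((R : ℝ) + 1) * Real.log 108 / ((1300 + 4 * Real.sqrt 2) * |β'| + (1 - 12 * |β'|))))) := (Real.exp_pos _).le
  calc (Real.sqrt (∫ x, (f (coords x) - ∫ z, f (coords z) ∂(wilsonMeasure (d := 3) (L := L) (fundamentalRep (Fin 2)) β')) ^ 2 ∂(wilsonMeasure (d := 3) (L := L) (fundamentalRep (Fin 2)) β')) * Real.sqrt (∫ x, (g (coords x) - ∫ z, g (coords z) ∂(wilsonMeasure (d := 3) (L := L) (fundamentalRep (Fin 2)) β')) ^ 2 ∂(wilsonMeasure (d := 3) (L := L) (fundamentalRep (Fin 2)) β')) + 8 * (∑ e : Edge 3 L, ℓF e) * (∑ e : Edge 3 L, ℓG e) * (((R : ℝ) + 1) * Real.log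 108 / ((1300 + 4 * Real.sqrt 2) * |β'| + (1 - 12 * |β'|)))) * Real.exp (-((1 - 12 * |β'|) * (((R : ℝ) + 1) * Real.log 108 / ((1300 + 4 * Real.sqrt 2) * |β'| + (1 - 12 * |β'|)))))
      ≤ (8 * (∑ e : Edge 3 L, ℓF e) * (∑ e : Edge 3 L, ℓG e) + 8 * (∑ e : Edge 3 L, ℓF e) * (∑ e : Edge 3 L, ℓG e) * (((R : ℝ) + 1) * Real.log 108 / ((1300 + 4 * Real.sqrt 2) * |β'| + (1 - 12 * |β'|)))) *
          Real.exp (-((1 - 12 * |β'|) * (((R : ℝ) + 1) * Real.log 108 / ((1300 + 4 * Real.sqrt 2) * |β'| + (1 - 12 * |β'|))))) := mul_le_mul_of_nonneg_right (add_le_add hprod le_rfl) hE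
    _ = _ := by ring


end Summit.QuantumFields.YangMills.Theorems.ColdStartUniversality.LiebRobinson
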